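import Summits.PneNP.PneNP.Theorems.EfNotPOptimalEFProofSearchOfCollapseNormalForm
import HarnessLib

/-!
# EF proof search under `P = NP` (item `EFProofSearchOfCollapse`), II: the normal form of an extended-Frege proof

Support file 2/5 for stmt-PneNP-18943. `exists_normalForm`: an extended-Frege proof `π` of `φ`
over `F` is rearranged into canonical extension lines `xvar L 0 ↔ ψ₀, …, xvar L (m-1) ↔ ψ_{m-1}`
(bodies using only variables with numerals of length `≤ L + j`) followed by lines `P`, each
inferred from the extension lines and the earlier lines of `P`, ending with `φ`, all variables with
numerals of length `≤ L + m`, of total size `≤ proofSize π` — provided every variable of `φ` has a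
numeral of length `< L`. Construction (`nfInv_step_inferred`, `nfInv_step_ext`,
`exists_nfInv_take`): process the lines in order; an extension axiom `p ↔ ψ` gives `p` the next
index; the substitution `tauOf` keeps the variables of `φ`, sends indexed variables to their `xvar`
and all other variables to `⊤`; inferences are closed under substitution (Cook–Reckhow's Lemma 2.5,
tree: `IsInferred.map_subst`), and freshness of the canonical variables is a numeral-length
comparison.

References: S. A. Cook, R. A. Reckhow, *The relative efficiency of propositional proof systems*,
JSL 44 (1979), §1 (Def. 1.5: the class `𝓛` of polynomial-time functions), §2 (Lemma 2.5, Thm. 2.3),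
§4 (Def. 4.1: the extension rule); J. Krajíček, *Bounded arithmetic, propositional logic, and
complexity theory* (CUP 1995), Def. 4.5.2; S. Arora, B. Barak, *Computational Complexity* (CUP 2009),
Thm. 2.18 (decision versus search).
-/

set_option linter.dupNamespace false

namespace Summit.PneNP.PneNP.Theorems.EFProofSearch

open _root_.Computability Literature.Computability.Complexity Literature.Computability.MetaComplexity
open Literature.Barriers.QuantumAdvantage.TQBFEval (varOcc)


/-! ### Completeness side: the normal form of an extended-Frege proof -/

section NormalForm

variable {F : FregeSystem} {φ : PropForm ℕ} {L : ℕ}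

/-- Every value of `tauOf` has size `1`. -/
theorem size_tauOf (φ : PropForm ℕ) (L : ℕ) (ext : ℕ → Option ℕ) (v : ℕ) :
    (tauOf φ L ext v).size ≤ 1 := by
  unfold tauOf
  split_ifs
  · rfl
  · cases ext v <;> rfl

/-- `tauOf` fixes the variables of `φ`. -/
theorem tauOf_of_mem_vars {ext : ℕ → Option ℕ} {v : ℕ} (hv : v ∈ φ.vars) :
    tauOf φ L ext v = .var v := by
  simp [tauOf, hv]

/-- Hence `tauOf` fixes `φ` itself. -/
theorem subst_tauOf_self (ext : ℕ → Option ℕ) : φ.subst (tauOf φ L ext) = φ := by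
  conv_rhs => rw [← PropForm.subst_var φ]
  exact PropForm.subst_congr fun x hx => tauOf_of_mem_vars hx

/-- The variables of a value of `tauOf`: a variable of `φ`, or `xvar L j` for an assigned index
`j`. -/
theorem mem_vars_tauOf {ext : ℕ → Option ℕ} {v w : ℕ} (h : w ∈ (tauOf φ L ext v).vars) :
    (w = v ∧ v ∈ φ.vars) ∨ ∃ j, ext v = some j ∧ w = xvar L j := by
  unfold tauOf at h
  split_ifs at h with hv
  · left
    simp only [PropForm.vars, Finset.mem_singleton] at h
    exact ⟨h, h ▸ hv⟩
  · right
    cases he : ext v with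
    | none => rw [he] at h; simp [PropForm.vars] at h
    | some j =>
      rw [he] at h
      simp only [PropForm.vars, Finset.mem_singleton] at h
      exact ⟨j, rfl, h⟩

/-- Numeral lengths of the variables of `χ τ`: if every variable of `φ` has a numeral of length
`< L` and every assigned index is `< m`, then every variable of `χ.subst (tauOf φ L ext)` has a
numeral of length `≤ L + m`. -/
theorem length_encodeNat_le_of_mem_vars_subst_tauOf {ext : ℕ → Option ℕ} {m : ℕ}
    (hL : ∀ v ∈ φ.vars, (encodeNat v).length < L)
    (hdom : ∀ p j, ext p = some j → j < m) {χ : PropForm ℕ} {w : ℕ}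
    (hw : w ∈ (χ.subst (tauOf φ L ext)).vars) : (encodeNat w).length ≤ L + m := by
  obtain ⟨x, -, hx⟩ := (PropForm.mem_vars_subst _ χ w).1 hw
  rcases mem_vars_tauOf hx with ⟨rfl, hv⟩ | ⟨j, hj, rfl⟩
  · have := hL _ hv; omega
  · have := hdom _ _ hj
    rw [length_encodeNat_xvar]
    omega

/-! The invariant of the normal-form construction after the prefix `pre` of the given extended-Frege
derivation has been processed — `items` the (index, body) pairs of the canonical extension lines
produced so far, `P` the renamed inferred lines, `ext` the assignment of indices to the original
extension variables — is the conjunction of: (idx) the indices are `0, 1, 2, …`; (vbE) bodies of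
extension lines only use short variables; (vbP) inferred lines only use short variables; (inf) every
line of `P` is inferred from the extension lines and the earlier lines of `P`; (dom) assigned indices
are below the number of extension lines and only variables occurring in the processed prefix carry an
index; (img) the renamed image of every processed line is available; (size) no size increase. It is
spelled out in each statement below (seven conjuncts, in this order). -/

/-- **Processing an inferred line**: its renamed image is appended to `P`
(Cook–Reckhow's Lemma 2.5: inferences are closed under substitution). -/
theorem nfInv_step_inferred {pre : List (PropForm ℕ)} {ext : ℕ → Option ℕ}
    {items : List (ℕ × PropForm ℕ)} {P : List (PropForm ℕ)} {θ : PropForm ℕ}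
    (hL : ∀ v ∈ φ.vars, (encodeNat v).length < L)
    (h : ((items).map Prod.fst = List.range (items).length ∧
      (∀ it ∈ items, ∀ v ∈ it.2.vars, (encodeNat v).length ≤ L + it.1) ∧
      (∀ χ ∈ P, ∀ v ∈ χ.vars, (encodeNat v).length ≤ L + (items).length) ∧
      (∀ (i : ℕ) (hi : i < (P).length), F.IsInferred ((items).map (extLine L) ++ (P).take i) (P)[i]) ∧
      (∀ p j, ext p = some j → j < (items).length ∧ ∃ χ ∈ pre, p ∈ χ.vars) ∧
      (∀ χ ∈ pre, χ.subst (tauOf φ L ext) ∈ (items).map (extLine L) ++ P) ∧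
      ((items).map fun it => it.2.size).sum + proofSize P ≤ proofSize pre))
    (hθ : F.IsInferred pre θ) :
    ((items).map Prod.fst = List.range (items).length ∧
      (∀ it ∈ items, ∀ v ∈ it.2.vars, (encodeNat v).length ≤ L + it.1) ∧
      (∀ χ ∈ (P ++ [θ.subst (tauOf φ L ext)]), ∀ v ∈ χ.vars, (encodeNat v).length ≤ L + (items).length) ∧
      (∀ (i : ℕ) (hi : i < ((P ++ [θ.subst (tauOf φ L ext)])).length), F.IsInferred ((items).map (extLine L) ++ ((P ++ [θ.subst (tauOf φ L ext)])).take i) ((P ++ [θ.subst (tauOf φ L ext)]))[i]) ∧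
      (∀ p j, ext p = some j → j < (items).length ∧ ∃ χ ∈ (pre ++ [θ]), p ∈ χ.vars) ∧
      (∀ χ ∈ (pre ++ [θ]), χ.subst (tauOf φ L ext) ∈ (items).map (extLine L) ++ (P ++ [θ.subst (tauOf φ L ext)])) ∧
      ((items).map fun it => it.2.size).sum + proofSize (P ++ [θ.subst (tauOf φ L ext)]) ≤ proofSize (pre ++ [θ])) := by
  obtain ⟨hidx, hvbE, hvbP, hinf, hdom, himg, hsize⟩ := h
  refine ⟨hidx, hvbE, ?_, ?_, ?_, ?_, ?_⟩
  · intro χ hχ v hv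
    rw [List.mem_append, List.mem_singleton] at hχ
    rcases hχ with hχ | rfl
    · exact hvbP χ hχ v hv
    · exact length_encodeNat_le_of_mem_vars_subst_tauOf hL (fun p j hp => (hdom p j hp).1) hv
  · intro i hi
    rw [List.length_append, List.length_singleton] at hi
    by_cases hi' : i < P.length
    · rw [List.getElem_append_left hi', List.take_append_of_le_length hi'.le]
      exact hinf i hi'
    · have hieq : i = P.length := by omega
      have htake : (P ++ [θ.subst (tauOf φ L ext)]).take i = P := by
        rw [List.take_append_of_le_length (by omega), hieq, List.take_length]
      rw [List.getElem_concat_length hieq, htake]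
      exact (hθ.map_subst (tauOf φ L ext)).mono fun χ hχ => by
        obtain ⟨χ₀, hχ₀, rfl⟩ := List.mem_map.1 hχ
        exact himg χ₀ hχ₀
  · intro p j hp
    obtain ⟨hj, χ, hχ, hpχ⟩ := hdom p j hp
    exact ⟨hj, χ, List.mem_append_left _ hχ, hpχ⟩
  · intro χ hχ
    rw [List.mem_append, List.mem_singleton] at hχ
    rcases hχ with hχ | rfl
    · have := himg χ hχ
      rw [List.mem_append] at this ⊢
      exact this.imp id (List.mem_append_left _)
    · exact List.mem_append_right _ (List.mem_append_right _ (List.mem_singleton_self _))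
  · have h2 : (θ.subst (tauOf φ L ext)).size ≤ θ.size := by
      have := PropForm.size_subst_le (le_refl 1) (size_tauOf φ L ext) θ
      simpa using this
    rw [proofSize_append, proofSize_append, proofSize_singleton, proofSize_singleton]
    omega

/-- **Processing an extension axiom** `p ↔ ψ` (`p` fresh): `p` receives the next index `m`, and
the canonical extension line `xvar L m ↔ ψτ` is appended to the extension lines. -/
theorem nfInv_step_ext {pre : List (PropForm ℕ)} {ext : ℕ → Option ℕ}
    {items : List (ℕ × PropForm ℕ)} {P : List (PropForm ℕ)} {θ : PropForm ℕ}
    (hL : ∀ v ∈ φ.vars, (encodeNat v).length < L)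
    (h : ((items).map Prod.fst = List.range (items).length ∧
      (∀ it ∈ items, ∀ v ∈ it.2.vars, (encodeNat v).length ≤ L + it.1) ∧
      (∀ χ ∈ P, ∀ v ∈ χ.vars, (encodeNat v).length ≤ L + (items).length) ∧
      (∀ (i : ℕ) (hi : i < (P).length), F.IsInferred ((items).map (extLine L) ++ (P).take i) (P)[i]) ∧
      (∀ p j, ext p = some j → j < (items).length ∧ ∃ χ ∈ pre, p ∈ χ.vars) ∧
      (∀ χ ∈ pre, χ.subst (tauOf φ L ext) ∈ (items).map (extLine L) ++ P) ∧
      ((items).map fun it => it.2.size).sum + proofSize P ≤ proofSize pre))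
    (hθ : FregeSystem.IsExtensionAxiom φ pre θ) :
    ∃ ext' : ℕ → Option ℕ, ∃ ψ' : PropForm ℕ,
    (((items ++ [(items.length, ψ')])).map Prod.fst = List.range ((items ++ [(items.length, ψ')])).length ∧
      (∀ it ∈ (items ++ [(items.length, ψ')]), ∀ v ∈ it.2.vars, (encodeNat v).length ≤ L + it.1) ∧
      (∀ χ ∈ P, ∀ v ∈ χ.vars, (encodeNat v).length ≤ L + ((items ++ [(items.length, ψ')])).length) ∧
      (∀ (i : ℕ) (hi : i < (P).length), F.IsInferred (((items ++ [(items.length, ψ')])).map (extLine L) ++ (P).take i) (P)[i]) ∧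
      (∀ p j, ext' p = some j → j < ((items ++ [(items.length, ψ')])).length ∧ ∃ χ ∈ (pre ++ [θ]), p ∈ χ.vars) ∧
      (∀ χ ∈ (pre ++ [θ]), χ.subst (tauOf φ L ext') ∈ ((items ++ [(items.length, ψ')])).map (extLine L) ++ P) ∧
      (((items ++ [(items.length, ψ')])).map fun it => it.2.size).sum + proofSize P ≤ proofSize (pre ++ [θ])) := by
  obtain ⟨hidx, hvbE, hvbP, hinf, hdom, himg, hsize⟩ := h
  obtain ⟨p, ψ, rfl, hpψ, hpφ, hprev⟩ := hθ
  set m := items.length with hm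
  -- `p` carries no index yet
  have hp0 : ext p = none := by
    cases he : ext p with
    | none => rfl
    | some j =>
      obtain ⟨-, χ, hχ, hpχ⟩ := hdom p j he
      exact absurd hpχ (hprev χ hχ)
  let ext' : ℕ → Option ℕ := fun v => if v = p then some m else ext v
  have hext'p : ext' p = some m := by simp [ext']
  have hext'ne : ∀ v, v ≠ p → ext' v = ext v := fun v hv => by simp [ext', hv]
  -- the two substitutions agree away from `p`
  have hτ : ∀ v, v ≠ p → tauOf φ L ext' v = tauOf φ L ext v := by
    intro v hv
    simp only [tauOf, hext'ne v hv]
  have hτp : tauOf φ L ext' p = .var (xvar L m) := by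
    simp only [tauOf, hpφ, if_false, hext'p]
  have hpre : ∀ χ ∈ pre, χ.subst (tauOf φ L ext') = χ.subst (tauOf φ L ext) := fun χ hχ =>
    PropForm.subst_congr fun x hx => hτ x (fun hxp => hprev χ hχ (hxp ▸ hx))
  have hψ : ψ.subst (tauOf φ L ext') = ψ.subst (tauOf φ L ext) :=
    PropForm.subst_congr fun x hx => hτ x (fun hxp => hpψ (hxp ▸ hx))
  have hdom0 : ∀ q j, ext q = some j → j < m := fun q j hq => (hdom q j hq).1
  refine ⟨ext', ψ.subst (tauOf φ L ext'), ?_, ?_, ?_, ?_, ?_, ?_, ?_⟩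
  · rw [List.map_append, hidx, List.length_append, List.length_singleton, List.range_succ]
    rfl
  · intro it hit v hv
    rw [List.mem_append, List.mem_singleton] at hit
    rcases hit with hit | rfl
    · exact hvbE it hit v hv
    · -- the new body `ψτ`: variables of `φ` or earlier extension variables
      rw [hψ] at hv
      exact length_encodeNat_le_of_mem_vars_subst_tauOf hL hdom0 hv
  · intro χ hχ v hv
    have := hvbP χ hχ v hv
    rw [List.length_append, List.length_singleton]
    omega
  · intro i hi
    rw [List.map_append, List.map_singleton]
    exact (hinf i hi).mono fun χ hχ => by
      rw [List.mem_append] at hχ ⊢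
      rcases hχ with hχ | hχ
      · exact Or.inl (List.mem_append_left _ hχ)
      · exact Or.inr hχ
  · intro q j hq
    rw [List.length_append, List.length_singleton]
    by_cases hqp : q = p
    · subst hqp
      rw [hext'p] at hq
      cases hq
      refine ⟨by omega, PropForm.biimp (.var q) ψ, List.mem_append_right _ (List.mem_singleton_self _), ?_⟩
      rw [vars_biimp, Finset.mem_union]
      exact Or.inl (by simp [PropForm.vars])
    · rw [hext'ne q hqp] at hq
      obtain ⟨hj, χ, hχ, hqχ⟩ := hdom q j hq
      exact ⟨by omega, χ, List.mem_append_left _ hχ, hqχ⟩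
  · have himgθ : (PropForm.biimp (.var p) ψ).subst (tauOf φ L ext') =
        extLine L (m, ψ.subst (tauOf φ L ext')) := by
      rw [biimp_subst, extLine]
      simp only [PropForm.subst, hτp]
    intro χ hχ
    rw [List.mem_append, List.mem_singleton] at hχ
    rw [List.map_append, List.map_singleton]
    rcases hχ with hχ | rfl
    · rw [hpre χ hχ]
      have := himg χ hχ
      rw [List.mem_append] at this ⊢
      rcases this with h1 | h1
      · exact Or.inl (List.mem_append_left _ h1)
      · exact Or.inr h1
    · rw [himgθ, List.mem_append]
      exact Or.inl (List.mem_append_right _ (List.mem_singleton_self _))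
  · have h2 : (ψ.subst (tauOf φ L ext')).size ≤ ψ.size := by
      have := PropForm.size_subst_le (le_refl 1) (size_tauOf φ L ext') ψ
      simpa using this
    have h3 : (PropForm.biimp (PropForm.var p) ψ).size = 2 * ψ.size + 7 := by
      rw [size_biimp]; simp [PropForm.size]; ring
    rw [List.map_append, List.map_singleton, List.sum_append, List.sum_singleton, proofSize_append,
      proofSize_singleton, h3]
    dsimp only
    omega

/-- The invariant can be maintained along every prefix of an extended-Frege derivation. -/
theorem exists_nfInv_take {π : List (PropForm ℕ)} (hL : ∀ v ∈ φ.vars, (encodeNat v).length < L)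
    (hπ : F.IsEFDerivation φ π) (n : ℕ) (hn : n ≤ π.length) :
    ∃ (ext : ℕ → Option ℕ) (items : List (ℕ × PropForm ℕ)) (P : List (PropForm ℕ)),
    ((items).map Prod.fst = List.range (items).length ∧
      (∀ it ∈ items, ∀ v ∈ it.2.vars, (encodeNat v).length ≤ L + it.1) ∧
      (∀ χ ∈ P, ∀ v ∈ χ.vars, (encodeNat v).length ≤ L + (items).length) ∧
      (∀ (i : ℕ) (hi : i < (P).length), F.IsInferred ((items).map (extLine L) ++ (P).take i) (P)[i]) ∧
      (∀ p j, ext p = some j → j < (items).length ∧ ∃ χ ∈ (π.take n), p ∈ χ.vars) ∧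
      (∀ χ ∈ (π.take n), χ.subst (tauOf φ L ext) ∈ (items).map (extLine L) ++ P) ∧
      ((items).map fun it => it.2.size).sum + proofSize P ≤ proofSize (π.take n)) := by
  induction n with
  | zero => exact ⟨fun _ => none, [], [], by simp⟩
  | succ n ih =>
    obtain ⟨ext, items, P, h⟩ := ih (Nat.le_of_succ_le hn)
    have hnlt : n < π.length := hn
    rw [List.take_succ_eq_append_getElem hnlt]
    rcases hπ n hnlt with hinf | hext
    · exact ⟨ext, items, _, nfInv_step_inferred hL h hinf⟩
    · obtain ⟨ext', ψ', h'⟩ := nfInv_step_ext hL h hext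
      exact ⟨ext', _, P, h'⟩

/-- **Normal form of extended-Frege proofs.** Every extended-Frege proof `π` of `φ` over `F` can
be replaced by canonical extension lines `xvar L 0 ↔ ψ₀, …, xvar L (m-1) ↔ ψ_{m-1}` (bodies using
only variables with numerals of length `≤ L + j`) followed by lines `P` each inferred from the
extension lines and the earlier lines of `P`, ending with `φ`, all variables having numerals of
length `≤ L + m`, of total size at most `proofSize π` — provided every variable of `φ` has a
numeral of length `< L`. (Move extension axioms to the front; substitute `⊤` for the variables
that are neither extension variables nor in `φ`; rename the extension variables; derivations are
closed under substitution, Cook–Reckhow's Lemma 2.5.) [Cook–Reckhow 1979, §2 Lemma 2.5, §4] -/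
theorem exists_normalForm {π : List (PropForm ℕ)} (hπ : F.IsEFProofOf π φ)
    (hL : ∀ v ∈ φ.vars, (encodeNat v).length < L) :
    ∃ (items : List (ℕ × PropForm ℕ)) (P : List (PropForm ℕ)),
      items.map Prod.fst = List.range items.length ∧
      (∀ it ∈ items, ∀ v ∈ it.2.vars, (encodeNat v).length ≤ L + it.1) ∧
      (∀ χ ∈ P, ∀ v ∈ χ.vars, (encodeNat v).length ≤ L + items.length) ∧
      (∀ (i : ℕ) (hi : i < P.length), F.IsInferred (items.map (extLine L) ++ P.take i) P[i]) ∧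
      P.getLast? = some φ ∧
      (items.map fun it => it.2.size).sum + proofSize P ≤ proofSize π ∧
      items.length ≤ proofSize π ∧ P.length ≤ proofSize π := by
  obtain ⟨hder, hlast⟩ := hπ
  have hne : π ≠ [] := by rintro rfl; simp at hlast
  set N := π.length - 1 with hN
  have hNlt : N < π.length := by
    have := List.length_pos_of_ne_nil hne; omega
  have hπN : π[N] = φ := by
    rw [List.getLast?_eq_some_getLast hne, Option.some.injEq] at hlast
    rw [← hlast, List.getLast_eq_getElem]
  -- process all lines but the last
  obtain ⟨ext, items, P, h⟩ := exists_nfInv_take hL hder N hNlt.le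
  -- the last line `φ` is inferred (an extension axiom `p ↔ ψ` contains its own fresh `p`)
  have hinfφ : F.IsInferred (π.take N) φ := by
    rcases hder N hNlt with hinf | ⟨p, ψ, hθ, -, hpφ, -⟩
    · rwa [hπN] at hinf
    · exfalso
      rw [hπN] at hθ
      apply hpφ
      rw [hθ, vars_biimp, Finset.mem_union]
      exact Or.inl (by simp [PropForm.vars])
  have h' := nfInv_step_inferred hL h hinfφ
  rw [subst_tauOf_self] at h'
  have hπeq : π.take N ++ [φ] = π := by
    rw [← hπN, ← List.take_succ_eq_append_getElem hNlt]
    exact List.take_of_length_le (by omega)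
  rw [hπeq] at h'
  obtain ⟨hidx, hvbE, hvbP, hinf, -, -, hsize⟩ := h'
  refine ⟨items, P ++ [φ], hidx, hvbE, hvbP, hinf, by simp, hsize, ?_, ?_⟩
  · -- every extension line has a body of positive size
    have hlen : items.length ≤ (items.map fun it => it.2.size).sum := by
      have h1 : ∀ it ∈ items, 1 ≤ it.2.size := fun it _ => it.2.size_pos
      calc items.length = (items.map fun _ => 1).sum := by simp
        _ ≤ (items.map fun it => it.2.size).sum := List.sum_le_sum (by simpa using h1)
    omega
  · have := length_le_proofSize (P ++ [φ])
    omega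

end NormalForm
end Summit.PneNP.PneNP.Theorems.EFProofSearch
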